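import Literature.Computability.QuantumComplexity.GenKitAbstract
import Literature.Computability.QuantumComplexity.CoreDescBlockFP
import HarnessLib

/-!
# The generic kit parameters `GP` on codes

Topic `Literature/Computability/QuantumComplexity`; the on-codes half of `GenKitAbstract.lean`, verbatim after
`CoreDescBlockFP.lean` §BP (there for the AJL record `AJLCore.BP`; here for `GP`, whose dummy offset is a field): the
code `gpE` of the parameters (five unary numbers) and polynomial-time functions on codes (`Complexity/CodeFP.lean`)
for every derived number, wire and wire list of `GP`, the abstract layouts (`GP.layA_layoutFP : LayoutFP gpE GP.layA GP.Wd`),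
and **`GP.gopsA_fp`** — the compiled flag programs `(p, ins, c) ↦ p.gopsA ins c` on codes (by `RevDesc.compile_codeFP`).
This is the input the uniformity of the Grover–Rudolph and Fourier stages of Regev's sampler needs for the gadget words
(`GenKit.map_val_gadgetOps`, `QFTKit.map_val_gadgetOps`). Everything is proved; no named fact is introduced.

## References

* S. Arora, B. Barak, *Computational Complexity: A Modern Approach*, CUP 2009, §1.3, §6.2 and proof of Thm. 6.15
  [AroraBarak2009].
* O. Regev, J. ACM 56(6) (2009), Lemma 3.14 (proof: uniformity of the sampler) [Regev2009].
-/

noncomputable section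

namespace Literature.Computability.QuantumComplexity

open _root_.Computability Cryptography Complexity Complexity.CodeFP SLP RevDesc AJLCore

/-- The code of generic kit parameters: five unary numbers. [folklore] -/
def gpE : GP → List Bool := fun p => pairE unE (pairE unE (pairE unE (pairE unE unE))) (p.dOff, p.k, p.R, p.F, p.T)

namespace GP

/-- The five fields, in unary. [folklore] -/
theorem fields_u : CodeFP gpE unE GP.dOff ∧ CodeFP gpE unE GP.k ∧ CodeFP gpE unE GP.R ∧ CodeFP gpE unE GP.F ∧ CodeFP gpE unE GP.T := by
  have h : CodeFP gpE (pairE unE (pairE unE (pairE unE (pairE unE unE)))) (fun p => (p.dOff, p.k, p.R, p.F, p.T)) := transparent fun _ => rfl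
  exact ⟨h.fst', h.snd'.fst', h.snd'.snd'.fst', h.snd'.snd'.snd'.fst', h.snd'.snd'.snd'.snd'⟩

/-- `Wd = 4k + 16`, in unary. [folklore] -/
theorem Wd_u : CodeFP gpE unE GP.Wd := ((affUn 4 16).comp fields_u.2.1).congr fun _ => rfl

/-- `scr = 3·Wd + 1`, in unary. [folklore] -/
theorem scr_u : CodeFP gpE unE GP.scr := ((affUn 12 49).comp fields_u.2.1).congr fun p => by show 12 * p.k + 49 = 3 * (4 * p.k + 16) + 1; ring

/-- `rs = R·Wd + F + T·scr`, in unary. [folklore] -/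
theorem rs_u : CodeFP gpE unE GP.rs := by
  obtain ⟨-, -, hR, hF, hT⟩ := fields_u
  exact (BP.uadd (BP.uadd (BP.umul hR Wd_u) hF) (BP.umul hT scr_u)).congr fun _ => rfl

/-- `rbv`, in unary. [folklore] -/
theorem rbv_u : CodeFP gpE unE GP.rbv := by
  obtain ⟨hd, hk, -, -, -⟩ := fields_u
  exact (BP.uadd (BP.uadd (BP.uadd hd (BP.uconst _ 2)) hk) (BP.uadd hk rs_u)).congr fun _ => rfl

/-- The block size `b`, in unary. [folklore] -/
theorem b_u : CodeFP gpE unE GP.b := (BP.uadd rbv_u rs_u).congr fun _ => rfl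

/-- The flag base, in unary. [folklore] -/
theorem fb_u : CodeFP gpE unE GP.fb := (BP.uadd rbv_u (BP.umul fields_u.2.2.1 Wd_u)).congr fun _ => rfl

/-- The scratch base, in unary. [folklore] -/
theorem sb_u : CodeFP gpE unE GP.sb := (BP.uadd fb_u fields_u.2.2.2.1).congr fun _ => rfl

/-- **Wires `v % b`, uncurried: `(P, v) ↦ P.w v`.** (The curried context form would restate `AJLCore.BP.w_fp` verbatim;
the generation kit states it on the pair instead.) [folklore] -/
theorem w_fp : CodeFP (pairE gpE natE) natE (fun p => p.1.w p.2) := (natMod.comp ((snd _ _).pair (BP.toNat (b_u.comp (fst _ _)))) :)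

/-- **The flag wire of a compiler output, uncurried: `(P, c) ↦ P.gflagA c`.** [folklore] -/
theorem gflagA_fp : CodeFP (pairE gpE outBE) natE (fun p => p.1.gflagA p.2) :=
  (w_fp.comp ((fst _ _).pair (natAdd.comp ((BP.toNat (fb_u.comp (fst _ _))).pair (BP.toNat (snd _ _).snd'.fst')))) :)

/-- The selector wire. [folklore] -/
theorem cr_n : CodeFP gpE natE GP.cr := (w_fp.comp (((CodeFP.id _)).pair (BP.toNat (BP.uadd fields_u.1 (BP.uconst _ 1)))))
/-- The dummy wire. [folklore] -/
theorem d0_n : CodeFP gpE natE GP.d0 := (w_fp.comp (((CodeFP.id _)).pair (BP.toNat fields_u.1)))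

/-- The averaging wires. [folklore] -/
theorem as_fp : CodeFP gpE (rawE natE) GP.as :=
  ((map (σ := GP) (α := ℕ) (g := fun t => t.1.w (t.1.dOff + 2 + t.2))
      ((w_fp.comp (((fst _ _)).pair (natAdd.comp ((natAdd.comp ((BP.toNat (fields_u.1.comp (fst _ _))).pair (const _ 2))).pair (snd _ _))))))).comp
    ((CodeFP.id _).pair (urange.comp fields_u.2.1))).congr fun _ => rfl

/-- The helper wires. [folklore] -/
theorem hs_fp : CodeFP gpE (rawE natE) GP.hs :=
  ((map (σ := GP) (α := ℕ) (g := fun t => t.1.w (t.1.dOff + 2 + t.1.k + t.2))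
      ((w_fp.comp (((fst _ _)).pair (natAdd.comp ((natAdd.comp ((natAdd.comp ((BP.toNat (fields_u.1.comp (fst _ _))).pair (const _ 2))).pair
        (BP.toNat (fields_u.2.1.comp (fst _ _))))).pair (snd _ _))))))).comp
    ((CodeFP.id _).pair (urange.comp (BP.uadd fields_u.2.1 rs_u)))).congr fun _ => rfl

/-- An offset range `[base + i | i < len]` from a unary length. [folklore] -/
theorem offRange_fp {base len : GP → ℕ} (hb : CodeFP gpE natE base) (hl : CodeFP gpE unE len) :
    CodeFP gpE (rawE natE) (fun p => (List.range (len p)).map fun i => base p + i) :=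
  ((map (σ := GP) (α := ℕ) (g := fun t => base t.1 + t.2) (natAdd.comp ((hb.comp (fst _ _)).pair (snd _ _)))).comp ((CodeFP.id _).pair (urange.comp hl))).congr fun _ => rfl

/-- The classical region. [folklore] -/
theorem region_fp : CodeFP gpE (rawE natE) GP.region := by
  have h3 : CodeFP gpE (rawE natE) (fun p => (List.range (p.R * p.Wd)).map (fun i => p.rbv + i) ++ (List.range p.F).map (fun i => p.fb + i) ++
      (List.range (p.T * p.scr)).map (fun i => p.sb + i)) :=
    ((rawAppend natE).comp (((rawAppend natE).comp ((offRange_fp (BP.toNat rbv_u) (BP.umul fields_u.2.2.1 Wd_u)).pair (offRange_fp (BP.toNat fb_u) fields_u.2.2.2.1))).pair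
      (offRange_fp (BP.toNat sb_u) (BP.umul fields_u.2.2.2.2 scr_u))) :)
  exact ((map (σ := GP) (α := ℕ) (g := fun t => t.1.w t.2) w_fp).comp ((CodeFP.id _).pair h3)).congr fun _ => rfl

/-- **The kit reflection on codes.** [folklore] -/
theorem GRA_fp : CodeFP gpE (rawE agE0) GP.GRA :=
  (reflectA_fp.comp (cr_n.pair (((rawAppend natE).comp (as_fp.pair region_fp)).pair hs_fp))).congr fun _ => rfl

/-- **The abstract layouts are computed on codes.** [folklore] -/
theorem layA_layoutFP : LayoutFP gpE GP.layA GP.Wd where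
  iw := by
    have hP : CodeFP (pairE (pairE gpE (rawE natE)) natE) gpE (fun t => t.1.1) := (fst _ _).fst'
    have hj : CodeFP (pairE (pairE gpE (rawE natE)) natE) natE (fun t => t.2) := snd _ _
    have hk : CodeFP (pairE (pairE gpE (rawE natE)) natE) natE (fun t => t.1.1.k) := BP.toNat (fields_u.2.1.comp hP)
    have h1 : CodeFP (pairE (pairE gpE (rawE natE)) natE) natE (fun t => t.1.1.w (t.1.1.dOff + 2 + t.2)) :=
      (w_fp.comp (hP.pair (natAdd.comp ((natAdd.comp ((BP.toNat (fields_u.1.comp hP)).pair (const _ 2))).pair hj))))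
    have h3 : CodeFP (pairE (pairE gpE (rawE natE)) natE) natE (fun t => t.1.2.getD (t.2 - (t.1.1.k + 1)) t.1.1.cr) :=
      ((rawGetOr natE).comp ((fst _ _).snd'.pair ((natSub.comp (hj.pair (natAdd.comp (hk.pair (const _ 1))))).pair (cr_n.comp hP))) :)
    exact (iteProp (natLt.comp (hj.pair hk)) h1 (iteProp (natEq.comp (hj.pair hk)) (cr_n.comp hP) h3)).congr fun _ => rfl
  rb := (BP.toNat (rbv_u.comp (fst _ _))).congr fun _ => rfl
  fb := (BP.toNat (fb_u.comp (fst _ _))).congr fun _ => rfl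
  sb := (BP.toNat (sb_u.comp (fst _ _))).congr fun _ => rfl
  wd := Wd_u

/-- Reducing the wires of a gate modulo the block size, in a context. [folklore] -/
theorem clopMapW_fp : CodeFP (pairE gpE clopE) clopE (fun t => t.2.map t.1.w) := by
  have hT : CodeFP (pairE gpE clopE) ctE (fun t => clopTuple t.2) := (transparent (eα := clopE) (eβ := ctE) (g := clopTuple) fun _ => rfl).comp (snd _ _)
  have hws : CodeFP (pairE gpE clopE) (rawE natE) (fun t => (clopTuple t.2).2.map t.1.w) :=
    ((map (σ := GP) (α := ℕ) (g := fun q => q.1.w q.2) w_fp).comp ((fst _ _).pair hT.snd')).congr fun _ => rfl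
  exact clop_of_tuple (hT.fst'.pair hws) fun t => BP.clopTuple_map _ _

/-- **Compiled flag programs on codes**: `(p, ins, c) ↦ p.gopsA ins c`. [cite: AroraBarak2009, §1.3 and §6.2] -/
theorem gopsA_fp : CodeFP (pairE gpE (pairE (rawE natE) outBE)) (rawE clopE) (fun t => t.1.gopsA t.2.1 t.2.2) := by
  have hc : CodeFP (pairE gpE (pairE (rawE natE) outBE)) (rawE clopE) (fun t => SLP.compile (t.1.layA t.2.1) (Wd := t.1.Wd) t.2.2.1) :=
    (compile_codeFP layA_layoutFP).comp ((fst _ _).pair ((snd _ _).fst'.pair (snd _ _).snd'.fst'))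
  exact ((map (σ := GP) (α := ClOp ℕ) (g := fun q => q.2.map q.1.w) clopMapW_fp).comp ((fst _ _).pair hc)).congr fun _ => rfl

/-! ### The two kits' parameters from their sizes -/

/-- `GenKit.gpOf ps dsz k` on codes, from `dsz`, `k` and the three program bounds in unary. [folklore] -/
theorem gpOf_codeFP {σ : Type} {eσ : σ → List Bool} {d k R F T : σ → ℕ} (hd : CodeFP eσ unE d) (hk : CodeFP eσ unE k)
    (hR : CodeFP eσ unE R) (hF : CodeFP eσ unE F) (hT : CodeFP eσ unE T) :
    CodeFP eσ gpE (fun c => (⟨d c, k c, R c, F c, T c⟩ : GP)) :=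
  (transparent (eα := pairE unE (pairE unE (pairE unE (pairE unE unE)))) (eβ := gpE) (g := fun t => (⟨t.1, t.2.1, t.2.2.1, t.2.2.2.1, t.2.2.2.2⟩ : GP))
    fun _ => rfl).comp (hd.pair (hk.pair (hR.pair (hF.pair hT))))

end GP

end Literature.Computability.QuantumComplexity

end
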